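import Summits.Ventures.PercRepro.Night2StarIdentity

/-!
# PercRepro — the DECAY LEMMA: a point outside the closure of the cyclic part destroys a coloop
(night-2 gen 3, NIGHT-2-profile.md §2 Lemma D)

For a set `S` with coloops `K = coloopsOf M S` and cyclic part `Z = S ∖ K`, and a point `x ∉ S` with `x ∈ cl(S)`:

* `coloopsOf_insert_subset`: every coloop of `M|(S ∪ x)` is a coloop of `M|S` (`x` is not one, and no point of `Z` is);
* `mem_closure_erase_of_mem_coloopsOf_insert`: a coloop `k` of `S` SURVIVES in `S ∪ x` iff `x ∈ cl(S ∖ k)`;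
* `mem_closure_sdiff_of_forall_mem_closure_erase`: if `x ∈ cl(S ∖ k)` for every `k ∈ K′ ⊆ K` then `x ∈ cl(S ∖ K′)`
  — the intersection of the hyperplanes `cl(S ∖ k)` is `cl(Z)`, by submodularity of the rank one coloop at a time;
* **`mTr_insert_add_one_le_of_notMem_closure`**: if `x ∉ cl(Z)` then `m(S ∪ x) + 1 ≤ m(S)` — the cyclic rank
  `ρ = q − m` goes UP by at least one;
* `coloopsOf_insert_eq_of_mem_closure`: if `x ∈ cl(Z)` then `m(S ∪ x) = m(S)` — a STAY move;
* `mTr_insert_add_one_le_of_mem_Rq`: the spanning-set form on a rank-`q` set `G`.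

This is the structural input the level counts lack (NIGHT-2-profile.md §1.3–§2): it bounds the sets of small cyclic
rank at one level by those at the level below (the profile LP of §3).  Imports `Night2StarIdentity` (d54) only.
-/
namespace PercRepro.Star

open Finset ThmH SixFour GenQ

variable {α : Type*} [DecidableEq α] {M : Matroid α} [M.Finite]

/-- A point of the ground set whose insertion does not raise the rank lies in the closure. -/
theorem mem_closure_of_eRk_insert_le' {X : Finset α} {a : α} (ha : a ∈ gr M)
    (h : M.eRk ((insert a X : Finset α) : Set α) ≤ M.eRk (X : Set α)) : a ∈ M.closure (X : Set α) := by
  by_contra hcl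
  have haE : a ∈ M.E := by
    rw [← coe_gr M]
    exact Finset.mem_coe.2 ha
  have h1 := Matroid.eRk_insert_eq_add_one (M := M) (e := a) (X := (X : Set α)) ⟨haE, hcl⟩
  rw [Finset.coe_insert] at h
  rw [h1] at h
  obtain ⟨k, hk⟩ := exists_eRk_eq_nat (M := M) X
  rw [hk] at h
  have : (k : ℕ∞) + 1 ≤ (k : ℕ∞) := h
  have h2 : k + 1 ≤ k := by exact_mod_cast this
  omega

/-! ## Which coloops survive an insertion -/

/-- Every coloop of `M|(S ∪ x)` is a coloop of `M|S`, when `x ∉ S` and `x ∈ cl(S)`. -/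
theorem coloopsOf_insert_subset {S : Finset α} {x : α} (hxS : x ∉ S)
    (hxcl : x ∈ M.closure (S : Set α)) : coloopsOf M (insert x S) ⊆ coloopsOf M S := by
  intro y hy
  rw [mem_coloopsOf] at hy ⊢
  obtain ⟨hyI, hycl⟩ := hy
  by_cases hyx : y = x
  · subst hyx
    exfalso
    apply hycl
    rw [Finset.erase_insert hxS]
    exact hxcl
  · refine ⟨Finset.mem_of_mem_insert_of_ne hyI hyx, fun h => hycl ?_⟩
    refine M.closure_subset_closure ?_ h
    exact Finset.coe_subset.2 (Finset.erase_subset_erase y (Finset.subset_insert x S))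

/-- A coloop `k` of `M|S` survives in `M|(S ∪ x)` only if `x ∈ cl(S ∖ k)` (for `x ∉ S`, `x ∈ cl(S)`). -/
theorem mem_closure_erase_of_mem_coloopsOf_insert {S : Finset α} (hS : S ⊆ gr M) {x : α}
    (hxE : x ∈ gr M) (hxS : x ∉ S) (hxcl : x ∈ M.closure (S : Set α)) {k : α} (hk : k ∈ coloopsOf M S)
    (hk' : k ∈ coloopsOf M (insert x S)) : x ∈ M.closure ((S.erase k : Finset α) : Set α) := by
  by_contra hx
  have hkS : k ∈ S := (mem_coloopsOf.1 hk).1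
  have hkx : x ≠ k := fun h => hxS (h ▸ hkS)
  have hk'' := (mem_coloopsOf.1 hk').2
  rw [Finset.erase_insert_of_ne hkx] at hk''
  apply hk''
  -- `S ∖ k` has rank `q − 1`, `(S ∖ k) ∪ x` has rank `q`, and so has `S ∪ x = ((S ∖ k) ∪ x) ∪ k`
  have hxE' : x ∈ M.E := by
    rw [← coe_gr M]
    exact Finset.mem_coe.2 hxE
  have h1 : M.eRk ((insert x (S.erase k) : Finset α) : Set α) = M.eRk ((S.erase k : Finset α) : Set α) + 1 := by
    rw [Finset.coe_insert]
    exact Matroid.eRk_insert_eq_add_one ⟨hxE', hx⟩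
  have h2 := eRk_erase_add_one_of_notMem_closure hS hkS (mem_coloopsOf.1 hk).2
  have h3 : M.eRk ((insert x S : Finset α) : Set α) = M.eRk (S : Set α) := by
    rw [Finset.coe_insert, ← Matroid.eRk_closure_eq, Matroid.closure_insert_eq_of_mem_closure hxcl,
      Matroid.eRk_closure_eq]
  have hkE : k ∈ gr M := hS hkS
  apply mem_closure_of_eRk_insert_le' hkE
  have heq : insert k (insert x (S.erase k)) = insert x S := by
    rw [Finset.insert_comm, Finset.insert_erase hkS]
  rw [heq, h1, h2]
  exact h3.le

/-- If `x ∈ cl(S ∖ k)` for every `k` in a set `K′` of coloops of `M|S`, then `x ∈ cl(S ∖ K′)`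
(the hyperplanes `cl(S ∖ k)` meet in `cl(S ∖ K′)`: one coloop at a time, by submodularity). -/
theorem mem_closure_sdiff_of_forall_mem_closure_erase {S : Finset α} (hS : S ⊆ gr M) {x : α}
    (hxE : x ∈ gr M) (hxcl : x ∈ M.closure (S : Set α))
    (hstay : ∀ k ∈ coloopsOf M S, x ∈ M.closure ((S.erase k : Finset α) : Set α)) (K' : Finset α)
    (hK' : K' ⊆ coloopsOf M S) : x ∈ M.closure ((S \ K' : Finset α) : Set α) := by
  induction K' using Finset.induction_on with
  | empty =>
    rw [Finset.sdiff_empty]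
    exact hxcl
  | insert k K' hkK' ih =>
    have hkK : k ∈ coloopsOf M S := hK' (Finset.mem_insert_self k K')
    have hK'K : K' ⊆ coloopsOf M S := (Finset.subset_insert k K').trans hK'
    have ih' := ih hK'K
    have hk := hstay k hkK
    have hkS : k ∈ S := (mem_coloopsOf.1 hkK).1
    -- the two flats
    set X : Set α := M.closure ((S \ K' : Finset α) : Set α) with hX
    set Y : Set α := M.closure ((S.erase k : Finset α) : Set α) with hY
    set A : Finset α := S \ insert k K' with hA
    have hAsub1 : A ⊆ S \ K' := Finset.sdiff_subset_sdiff (Finset.Subset.refl S) (Finset.subset_insert k K')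
    have hAsub2 : A ⊆ S.erase k := by
      intro a ha
      rw [hA, Finset.mem_sdiff, Finset.mem_insert] at ha
      exact Finset.mem_erase.2 ⟨fun h => ha.2 (Or.inl h), ha.1⟩
    have hSE : (S : Set α) ⊆ M.E := by
      rw [← coe_gr M]
      exact Finset.coe_subset.2 hS
    have hsub1E : ((S \ K' : Finset α) : Set α) ⊆ M.E := (Finset.coe_subset.2 Finset.sdiff_subset).trans hSE
    have hsub2E : ((S.erase k : Finset α) : Set α) ⊆ M.E :=
      (Finset.coe_subset.2 (Finset.erase_subset k S)).trans hSE
    -- `insert x A ⊆ X ∩ Y`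
    have hxA : ((insert x A : Finset α) : Set α) ⊆ X ∩ Y := by
      rw [Finset.coe_insert]
      intro y hy
      rcases Set.mem_insert_iff.1 hy with rfl | hyA
      · exact ⟨ih', hk⟩
      · have hyA' := Finset.mem_coe.1 hyA
        exact ⟨M.subset_closure _ hsub1E (Finset.mem_coe.2 (hAsub1 hyA')),
          M.subset_closure _ hsub2E (Finset.mem_coe.2 (hAsub2 hyA'))⟩
    -- `S ⊆ X ∪ Y`
    have hSXY : (S : Set α) ⊆ X ∪ Y := by
      intro s hs
      have hs' := Finset.mem_coe.1 hs
      by_cases hsK' : s ∈ K'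
      · have hsk : s ≠ k := fun h => hkK' (h ▸ hsK')
        exact Or.inr (M.subset_closure _ hsub2E (Finset.mem_coe.2 (Finset.mem_erase.2 ⟨hsk, hs'⟩)))
      · exact Or.inl (M.subset_closure _ hsub1E (Finset.mem_coe.2 (Finset.mem_sdiff.2 ⟨hs', hsK'⟩)))
    -- ranks
    have hsub := M.eRk_inter_add_eRk_union_le X Y
    rw [hX, hY, Matroid.eRk_closure_eq, Matroid.eRk_closure_eq] at hsub
    have hXY1 : M.eRk ((insert x A : Finset α) : Set α) ≤ M.eRk (X ∩ Y) := M.eRk_mono hxA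
    have hXY2 : M.eRk (S : Set α) ≤ M.eRk (X ∪ Y) := M.eRk_mono hSXY
    have e1 := eRk_sdiff_add_card_eq_of_subset_coloopsOf hS K' hK'K
    have e2 := eRk_erase_add_one_of_notMem_closure hS hkS (mem_coloopsOf.1 hkK).2
    have e3 := eRk_sdiff_add_card_eq_of_subset_coloopsOf hS (insert k K') hK'
    rw [Finset.card_insert_of_notMem hkK'] at e3
    obtain ⟨q, hq⟩ := exists_eRk_eq_nat (M := M) S
    obtain ⟨a, ha⟩ := exists_eRk_eq_nat (M := M) (S \ K')
    obtain ⟨b, hb⟩ := exists_eRk_eq_nat (M := M) (S.erase k)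
    obtain ⟨c, hc⟩ := exists_eRk_eq_nat (M := M) (insert x A)
    obtain ⟨d, hd⟩ := exists_eRk_eq_nat (M := M) A
    rw [hq, ha] at e1
    rw [hq, hb] at e2
    rw [hq, hd] at e3
    have e1' : a + K'.card = q := by exact_mod_cast e1
    have e2' : b + 1 = q := by exact_mod_cast e2
    have e3' : d + (K'.card + 1) = q := by exact_mod_cast e3
    have hmain : (c : ℕ∞) + (q : ℕ∞) ≤ (a : ℕ∞) + (b : ℕ∞) := by
      rw [← hc, ← hq, ← ha, ← hb]
      exact (add_le_add hXY1 hXY2).trans hsub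
    have hmain' : c + q ≤ a + b := by exact_mod_cast hmain
    have hcd : c ≤ d := by omega
    -- so inserting `x` into `A` does not raise the rank
    apply mem_closure_of_eRk_insert_le' hxE
    rw [hc, hd]
    exact_mod_cast hcd

/-! ## The decay lemma -/

/-- **Decay**: if `x ∉ S`, `x ∈ cl(S)` and `x ∉ cl(S ∖ coloopsOf S)` (the closure of the cyclic part), then
`m(S ∪ x) + 1 ≤ m(S)`. -/
theorem mTr_insert_add_one_le_of_notMem_closure {S : Finset α} (hS : S ⊆ gr M) {x : α} (hxE : x ∈ gr M)
    (hxS : x ∉ S) (hxcl : x ∈ M.closure (S : Set α))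
    (hx : x ∉ M.closure ((S \ coloopsOf M S : Finset α) : Set α)) :
    mTr M (insert x S) + 1 ≤ mTr M S := by
  have hsub := coloopsOf_insert_subset (M := M) hxS hxcl
  have hne : ∃ k ∈ coloopsOf M S, k ∉ coloopsOf M (insert x S) := by
    by_contra hall
    have hall' : ∀ k ∈ coloopsOf M S, k ∈ coloopsOf M (insert x S) :=
      fun k hk => by_contra (fun h => hall ⟨k, hk, h⟩)
    apply hx
    apply mem_closure_sdiff_of_forall_mem_closure_erase hS hxE hxcl _ (coloopsOf M S) (Finset.Subset.refl _)
    intro k hk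
    exact mem_closure_erase_of_mem_coloopsOf_insert hS hxE hxS hxcl hk (hall' k hk)
  have hss : coloopsOf M (insert x S) ⊂ coloopsOf M S := (Finset.ssubset_iff_of_subset hsub).2 hne
  unfold mTr
  exact Finset.card_lt_card hss

/-- **Stay**: if `x ∉ S` and `x ∈ cl(S ∖ coloopsOf S)` then the coloops are unchanged: `m(S ∪ x) = m(S)`. -/
theorem coloopsOf_insert_eq_of_mem_closure {S : Finset α} (hS : S ⊆ gr M) {x : α} (hxS : x ∉ S)
    (hx : x ∈ M.closure ((S \ coloopsOf M S : Finset α) : Set α)) :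
    coloopsOf M (insert x S) = coloopsOf M S := by
  have hSE : (S : Set α) ⊆ M.E := by
    rw [← coe_gr M]
    exact Finset.coe_subset.2 hS
  have hxcl : x ∈ M.closure (S : Set α) :=
    M.closure_subset_closure (Finset.coe_subset.2 Finset.sdiff_subset) hx
  apply Finset.Subset.antisymm (coloopsOf_insert_subset hxS hxcl)
  intro k hk
  have hkS : k ∈ S := (mem_coloopsOf.1 hk).1
  have hkx : x ≠ k := fun h => hxS (h ▸ hkS)
  rw [mem_coloopsOf]
  refine ⟨Finset.mem_insert_of_mem hkS, ?_⟩
  rw [Finset.erase_insert_of_ne hkx, Finset.coe_insert]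
  -- `x ∈ cl(S ∖ K) ⊆ cl(S ∖ k)`, so `cl(x ∪ (S ∖ k)) = cl(S ∖ k) ∌ k`
  have hxk : x ∈ M.closure ((S.erase k : Finset α) : Set α) := by
    refine M.closure_subset_closure ?_ hx
    intro y hy
    have hy' := Finset.mem_coe.1 hy
    rw [Finset.mem_sdiff] at hy'
    exact Finset.mem_coe.2 (Finset.mem_erase.2 ⟨fun h => hy'.2 (h ▸ hk), hy'.1⟩)
  rw [Matroid.closure_insert_eq_of_mem_closure hxk]
  exact (mem_coloopsOf.1 hk).2

/-! ## The spanning-set form -/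

/-- On a rank-`q` set `G`: for `S ∈ R_q(G)`, `x ∈ G ∖ S` and `x ∉ cl(S ∖ coloopsOf S)`, the set `S ∪ x ∈ R_q(G)`
has `m(S ∪ x) + 1 ≤ m(S)`, i.e. its cyclic rank is at least `ρ(S) + 1`. -/
theorem mTr_insert_add_one_le_of_mem_Rq {G S : Finset α} {q : ℕ} (hG : G ⊆ gr M)
    (hrG : M.eRk (G : Set α) = (q : ℕ∞)) (hS : S ∈ Rq M G q) {x : α} (hxG : x ∈ G) (hxS : x ∉ S)
    (hx : x ∉ M.closure ((S \ coloopsOf M S : Finset α) : Set α)) :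
    insert x S ∈ Rq M G q ∧ mTr M (insert x S) + 1 ≤ mTr M S := by
  have hS' := mem_Rq.1 hS
  have hsub : insert x S ⊆ G := Finset.insert_subset hxG hS'.1
  have hr : M.eRk ((insert x S : Finset α) : Set α) = (q : ℕ∞) := by
    apply le_antisymm
    · rw [← hrG]
      exact M.eRk_mono (Finset.coe_subset.2 hsub)
    · rw [← hS'.2]
      exact M.eRk_mono (Finset.coe_subset.2 (Finset.subset_insert x S))
  have hxcl : x ∈ M.closure (S : Set α) := by
    apply mem_closure_of_eRk_insert_le' (hG hxG)
    rw [hr, hS'.2]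
  exact ⟨mem_Rq.2 ⟨hsub, hr⟩,
    mTr_insert_add_one_le_of_notMem_closure (hS'.1.trans hG) (hG hxG) hxS hxcl hx⟩

end PercRepro.Star
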